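import Summits.QuantumFields.YangMills.Theorems.BalabanUVNodesN20KeyedRelWeightSocketAtRecord13CoPH
import Summits.QuantumFields.YangMills.Theorems.BalabanUVNodesSpineReadingOfRecord13CoPHV

/-!
# BalabanUVNodes ∕ N20 (NE7b) + the N21 shell face — THE SOCKETS AT THE SPINE READING OF RECORD WITH THE PHYSICAL VOLUME LETTER `crOfRecord₁₃VAt K₀ jcut sh`
# (dag-n20-d's edition V, `Thm/BalabanUVNodesSpineReadingOfRecord13CoPHV`, `vol := F.side ^ 4`; the record pointer the K3⁷ v3 skeleton pins EVERYWHERE, plan g79∕g80 (w18)):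
# the edition-V twins of `…N20KeyedRelWeightSocketAtRecord13CoPH` §2–§3, carriers-level §1 of that module reused BY NAME (the V reading has the SAME `T ∕ A ∕ B ∕ Bad ∕ W ∕ Wsh`)

Cell `pub-ymgap` (HUMAN RULING D-0062 Track A; director-ym №197 ∕ HUMAN RULING D-0149 width seats), seat `pub-ymgap-dag-n20-w1` (N20 NE7b WIDTH SEAT 1 of 3) gen 0,
module 3.  Why: dag-n20-d's CORRECTION (pub-ymgap INBOX l.25464) makes the physical-volume reading a SIBLING `crOfRecord₁₃VAt` (landed decls are immutable), plan's Q-SEL word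
(l.25488 ∕ l.25727, (w18)) points the K3⁷ v3 skeleton's `PinnedAtLive` at `crOfRecord₁₃V jcut sh := crOfRecord₁₃VAt 0 jcut sh`; dag-n19-d's N19′ face already has its V edition
(INTENT-K l.25666).  This file is the N20 face's (and the shell face's) V edition so that every keyed face exists at the v3 pointer.  Filed `--kind proof --supports
stmt-QuantumFields-20544 --as helper`; COUNT-NEUTRAL.

CONTENTS (theorems only; 0 `def`, 0 `sorry`; module 2 §1 `relWeightBound_carriersOfRecord₁₃_of_termBounds` ∕ `termBounds_of_relWeightBound_carriersOfRecord₁₃` + shell socket §1 + dag-n20-d's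
V transfers `relWeightBound_crOfRecord₁₃VAt` ∕ `shellWeightBound_crOfRecord₁₃VAt` + dag-n19-d's homes BY NAME — the volume letter is not read by either face):
★★ `relWeightBound_crOfRecord₁₃VAt_of_termBounds` · ★★ `relWeightBound_crOfRecord₁₃VAt_iff_exists_termBounds` · ★★ `s_N20_sRec₁₃CoPH_crOfRecord₁₃VAt_iff` (THE NODE AT THE V READING ⟺ per
tuple ∃ summable sub-unit `W` bounding the relative class weight of run A's ∕ run B's (2.18) sequences with an old large-field region at a level `≤ jcut K`) ·
★★ `relWeightBound_guarded_crOfRecord₁₃VAt_of_termBounds` (the v3 `KeyedRelWeight` binder shape at `cr := crOfRecord₁₃VAt …` on a regime `Rg`) · ★★ `s_N20_sRec₁₃CoPHOn_crOfRecord₁₃VAt_of_termBounds` ·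
★★ `shellWeightBound_crOfRecord₁₃VAt_of_termShell` · ★★ `s_N21_sRec₁₃CoPH_crOfRecord₁₃VAt_of_termShell`.

PIN CONSTRAINT ∕ DIAL (carried): `Bad := badClass₁₃ … jcut` reads NE7b's «old AND pending» only at the history-rewriting (live) pin (dag-n20-w3 LOCATED-1, dag-n20-d l.24693);
at `jcut := 0` the N20 face is FREE (dag-n20-w2 `…N20KeyedRelWeightCutZero` p590852, plan: intended) — the located NE7b content lives at the policy the closing proof of stub 2 uses.

HONEST FRAMING.  Count-neutral kernel bookkeeping; proves NO estimate (the right-hand sides are node N20's ∕ N21's XL bodies, NAMED OPEN, inhabited for no Bałaban family today —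
A6: LOCATED; every ★★ is an equivalence or its easy direction); NE7b ∕ NE7c NOT PRINTED for d = 4, NOT PROVED; no `Provisos₁₃CoPH` inhabitant claimed; (α)-instance 0∕1; N20 ∕ N21
NOT discharged; K3⁷ NOT closed; counts unmoved (typed 28∕28 · discharged 5∕27).  One finite `𝕋⁴_{L^K}` programme at fixed `ε = L^{−K}`, Bałaban AS PRINTED; the YM mass gap
(Clay) is NOT proved by any of this — R4 closes the conditional finite-𝕋⁴ rung `BalabanLadder.UV` only; nothing continuum ∕ ℝ⁴ ∕ OS.  No `instance`, no `notation`, no `def`.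
Sources (locators only): [Balaban1988Convergent] (2.18) p. 257; [Balaban1989LargeFieldII] (1.80) p. 384; [Balaban1989LargeFieldI] p. 193; [King1986] (3.10) p. 656.  No cite tags.
-/

noncomputable section

namespace Summit.QuantumFields.YangMills.BalabanUVNodes.N20KeyedRelWeightSocketAtRecord13CoPHV

open Literature.MathematicalPhysics.QuantumFieldTheory.Balaban1983to89 Literature.MathematicalPhysics.QuantumFieldTheory.Balaban1983to89.Node00
open scoped BigOperators
open T4Continuum B14.Eq218Concrete Summit.QuantumFields.BalabanUV.T4Continuum.Spine
open T4WeightBudget (RelWeightBound)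
open T4IndicatorShell (ShellWeightBound)
open YMDAG.UVSplit
open Summit.QuantumFields.YangMills.BalabanUVNodes.N21KeyedShellWeightSocket (shellWeightBound_keyed_of_termShell)
open Summit.QuantumFields.YangMills.BalabanUVNodes.N20KeyedRelWeightSocketAtRecord13CoPH

variable {F : T4Family} {N : ℕ} [NeZero N]

/-! ## §1 N20's face at the V reading `crOfRecord₁₃VAt K₀ jcut sh` (module 2 §2, one letter re-pinned) -/

section Reading

variable (K₀ : ℕ) (jcut : ℕ → ℕ) (sh : ShellSplit₁₃CoPH N K₀)

open Classical in
/-- ★★ **N20's FACE AT THE READING OF RECORD, ONE TUPLE, FROM TWO TERM-LEVEL BOUNDS**: a witness `W` (`0 ≤ W < 1`, `Σ W < ∞`) with the two displayed term-level bounds ⇒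
`RelWeightBound` AT `crOfRecord₁₃VAt K₀ jcut sh F θ hP g₀ os` (all six carriers the reading's own, `W` the canonical one; module 2 §1 ★ + dag-n20-d's `relWeightBound_crOfRecord₁₃VAt`).
[bookkeeping] -/
theorem relWeightBound_crOfRecord₁₃VAt_of_termBounds (θ : Stage13HParams F N) (hP : θ.Provisos₁₃CoPH F N) (g₀ : ℕ → ℝ) (os : List (ULoop F))
    {W : ℕ → ℝ} (hW0 : ∀ K, 0 ≤ W K) (hW1 : ∀ K, W K < 1) (hWs : Summable W)
    (hA : ∀ (K : ℕ) (t : ℝ), |t| ≤ 1 →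
      ∑ s ∈ Finset.univ.filter (fun s : SeqOfRecord F θ.ν θ.τ9.M (histA₁₃ θ K₀ g₀ K) (K₀ + K) (K₀ + K) => KeyOldLargeField (jcut K) (keyA₁₃ θ K₀ g₀ K s).2),
          classWeightOfDatum₉ F N θ.toStage9Params (datumOfRecord₁₃CoPH F N θ hP) g₀ os (runA₁₃ F K₀ g₀ K) (histA₁₃ θ K₀ g₀ K) (K₀ + K) t s
        ≤ W K * ∑ s, classWeightOfDatum₉ F N θ.toStage9Params (datumOfRecord₁₃CoPH F N θ hP) g₀ os (runA₁₃ F K₀ g₀ K) (histA₁₃ θ K₀ g₀ K) (K₀ + K) t s)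
    (hB : ∀ (K : ℕ) (t : ℝ), |t| ≤ 1 →
      ∑ s' ∈ Finset.univ.filter (fun s' : SeqOfRecord F θ.ν θ.τ9.M (histB₁₃ θ K₀ g₀ K) (K₀ + K + 1) (K₀ + K + 1) => KeyOldLargeField (jcut K) (keyB₁₃ θ K₀ g₀ K s').2),
          classWeightOfDatum₉ F N θ.toStage9Params (datumOfRecord₁₃CoPH F N θ hP) g₀ os (runB₁₃ F K₀ g₀ K) (histB₁₃ θ K₀ g₀ K) (K₀ + K + 1) t s'
        ≤ W K * ∑ s', classWeightOfDatum₉ F N θ.toStage9Params (datumOfRecord₁₃CoPH F N θ hP) g₀ os (runB₁₃ F K₀ g₀ K) (histB₁₃ θ K₀ g₀ K) (K₀ + K + 1) t s') :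
    RelWeightBound (crOfRecord₁₃VAt K₀ jcut sh F θ hP g₀ os).l₀ (crOfRecord₁₃VAt K₀ jcut sh F θ hP g₀ os).T (crOfRecord₁₃VAt K₀ jcut sh F θ hP g₀ os).A
      (crOfRecord₁₃VAt K₀ jcut sh F θ hP g₀ os).B (crOfRecord₁₃VAt K₀ jcut sh F θ hP g₀ os).Bad (crOfRecord₁₃VAt K₀ jcut sh F θ hP g₀ os).W :=
  relWeightBound_crOfRecord₁₃VAt K₀ jcut sh θ hP g₀ os (relWeightBound_carriersOfRecord₁₃_of_termBounds θ hP K₀ g₀ os jcut hW0 hW1 hWs hA hB)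

open Classical in
/-- ★★ **N20's FACE AT THE READING OF RECORD, ONE TUPLE, AS AN EQUIVALENCE**: `RelWeightBound` at `crOfRecord₁₃VAt K₀ jcut sh F θ hP g₀ os` ⟺ SOME `W` with `0 ≤ W < 1`,
`Σ W < ∞` and the two term-level bounds (⇒: the reading's own canonical `W` is the witness, module 2 §1 converse; ⇐: the previous theorem). [bookkeeping] -/
theorem relWeightBound_crOfRecord₁₃VAt_iff_exists_termBounds (θ : Stage13HParams F N) (hP : θ.Provisos₁₃CoPH F N) (g₀ : ℕ → ℝ) (os : List (ULoop F)) :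
    RelWeightBound (crOfRecord₁₃VAt K₀ jcut sh F θ hP g₀ os).l₀ (crOfRecord₁₃VAt K₀ jcut sh F θ hP g₀ os).T (crOfRecord₁₃VAt K₀ jcut sh F θ hP g₀ os).A
      (crOfRecord₁₃VAt K₀ jcut sh F θ hP g₀ os).B (crOfRecord₁₃VAt K₀ jcut sh F θ hP g₀ os).Bad (crOfRecord₁₃VAt K₀ jcut sh F θ hP g₀ os).W ↔
    ∃ W : ℕ → ℝ, (∀ K, 0 ≤ W K) ∧ (∀ K, W K < 1) ∧ Summable W ∧
      (∀ (K : ℕ) (t : ℝ), |t| ≤ 1 →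
        ∑ s ∈ Finset.univ.filter (fun s : SeqOfRecord F θ.ν θ.τ9.M (histA₁₃ θ K₀ g₀ K) (K₀ + K) (K₀ + K) => KeyOldLargeField (jcut K) (keyA₁₃ θ K₀ g₀ K s).2),
            classWeightOfDatum₉ F N θ.toStage9Params (datumOfRecord₁₃CoPH F N θ hP) g₀ os (runA₁₃ F K₀ g₀ K) (histA₁₃ θ K₀ g₀ K) (K₀ + K) t s
          ≤ W K * ∑ s, classWeightOfDatum₉ F N θ.toStage9Params (datumOfRecord₁₃CoPH F N θ hP) g₀ os (runA₁₃ F K₀ g₀ K) (histA₁₃ θ K₀ g₀ K) (K₀ + K) t s) ∧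
      (∀ (K : ℕ) (t : ℝ), |t| ≤ 1 →
        ∑ s' ∈ Finset.univ.filter (fun s' : SeqOfRecord F θ.ν θ.τ9.M (histB₁₃ θ K₀ g₀ K) (K₀ + K + 1) (K₀ + K + 1) => KeyOldLargeField (jcut K) (keyB₁₃ θ K₀ g₀ K s').2),
            classWeightOfDatum₉ F N θ.toStage9Params (datumOfRecord₁₃CoPH F N θ hP) g₀ os (runB₁₃ F K₀ g₀ K) (histB₁₃ θ K₀ g₀ K) (K₀ + K + 1) t s'
          ≤ W K * ∑ s', classWeightOfDatum₉ F N θ.toStage9Params (datumOfRecord₁₃CoPH F N θ hP) g₀ os (runB₁₃ F K₀ g₀ K) (histB₁₃ θ K₀ g₀ K) (K₀ + K + 1) t s') := by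
  constructor
  · intro h
    refine ⟨(crOfRecord₁₃VAt K₀ jcut sh F θ hP g₀ os).W, h.nonneg, h.lt_one, h.summable, ?_⟩
    exact termBounds_of_relWeightBound_carriersOfRecord₁₃ θ hP K₀ g₀ os jcut h
  · rintro ⟨W, hW0, hW1, hWs, hA, hB⟩
    exact relWeightBound_crOfRecord₁₃VAt_of_termBounds K₀ jcut sh θ hP g₀ os hW0 hW1 hWs hA hB

open Classical in
/-- ★★ **THE NODE AT THE READING OF RECORD**: `S_N20 (SRec₁₃CoPH (crOfRecord₁₃VAt K₀ jcut sh))` — the K5 stub N20 = NE7b's `RelWeightBound` at every admissible Stage-13 tuple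
with provisos, every `g₀`, `os` (dag-n19-d `s_N20_sRec₁₃CoPH_iff`) — ⟺ at every such tuple SOME `W` with `0 ≤ W < 1`, `Σ W < ∞` bounds the relative class weight of run A's
(2.18) sequences with an old large-field region at a level `≤ jcut K` and of run B's.  The right-hand side is N20's body at this reading (NOT PROVED; see the pin constraint).
[bookkeeping] -/
theorem s_N20_sRec₁₃CoPH_crOfRecord₁₃VAt_iff :
    S_N20 (SRec₁₃CoPH (crOfRecord₁₃VAt K₀ jcut sh)) ↔
    ∀ (F : T4Family) (θ : Stage13HParams F N) (hP : θ.Provisos₁₃CoPH F N), θ.Admissible F N → ∀ (g₀ : ℕ → ℝ) (os : List (ULoop F)),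
      ∃ W : ℕ → ℝ, (∀ K, 0 ≤ W K) ∧ (∀ K, W K < 1) ∧ Summable W ∧
        (∀ (K : ℕ) (t : ℝ), |t| ≤ 1 →
          ∑ s ∈ Finset.univ.filter (fun s : SeqOfRecord F θ.ν θ.τ9.M (histA₁₃ θ K₀ g₀ K) (K₀ + K) (K₀ + K) => KeyOldLargeField (jcut K) (keyA₁₃ θ K₀ g₀ K s).2),
              classWeightOfDatum₉ F N θ.toStage9Params (datumOfRecord₁₃CoPH F N θ hP) g₀ os (runA₁₃ F K₀ g₀ K) (histA₁₃ θ K₀ g₀ K) (K₀ + K) t s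
            ≤ W K * ∑ s, classWeightOfDatum₉ F N θ.toStage9Params (datumOfRecord₁₃CoPH F N θ hP) g₀ os (runA₁₃ F K₀ g₀ K) (histA₁₃ θ K₀ g₀ K) (K₀ + K) t s) ∧
        (∀ (K : ℕ) (t : ℝ), |t| ≤ 1 →
          ∑ s' ∈ Finset.univ.filter (fun s' : SeqOfRecord F θ.ν θ.τ9.M (histB₁₃ θ K₀ g₀ K) (K₀ + K + 1) (K₀ + K + 1) => KeyOldLargeField (jcut K) (keyB₁₃ θ K₀ g₀ K s').2),
              classWeightOfDatum₉ F N θ.toStage9Params (datumOfRecord₁₃CoPH F N θ hP) g₀ os (runB₁₃ F K₀ g₀ K) (histB₁₃ θ K₀ g₀ K) (K₀ + K + 1) t s'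
            ≤ W K * ∑ s', classWeightOfDatum₉ F N θ.toStage9Params (datumOfRecord₁₃CoPH F N θ hP) g₀ os (runB₁₃ F K₀ g₀ K) (histB₁₃ θ K₀ g₀ K) (K₀ + K + 1) t s') := by
  rw [s_N20_sRec₁₃CoPH_iff]
  refine forall_congr' fun F => forall_congr' fun θ => forall_congr' fun hP => forall_congr' fun _ => forall_congr' fun g₀ => forall_congr' fun os => ?_
  exact relWeightBound_crOfRecord₁₃VAt_iff_exists_termBounds K₀ jcut sh θ hP g₀ os

variable (Rg : (F : T4Family) → Stage13HParams F N → Prop)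

open Classical in
/-- ★★ **LEAF D's ∕ THE K3 SKELETON's `KeyedRelWeight` BINDER SHAPE AT `cr := crOfRecord₁₃VAt K₀ jcut sh`, REGIME-GUARDED** (`Rg F θ`, e.g. the item's guard `θ.ZhUnity F N ∧
θ.SlotsNondegenerate₁₃ F N`): from the per-tuple witnesses on the regime. [bookkeeping] -/
theorem relWeightBound_guarded_crOfRecord₁₃VAt_of_termBounds
    (hterm : ∀ (F : T4Family) (θ : Stage13HParams F N) (hP : θ.Provisos₁₃CoPH F N), Rg F θ → θ.Admissible F N → ∀ (g₀ : ℕ → ℝ) (os : List (ULoop F)),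
      ∃ W : ℕ → ℝ, (∀ K, 0 ≤ W K) ∧ (∀ K, W K < 1) ∧ Summable W ∧
        (∀ (K : ℕ) (t : ℝ), |t| ≤ 1 →
          ∑ s ∈ Finset.univ.filter (fun s : SeqOfRecord F θ.ν θ.τ9.M (histA₁₃ θ K₀ g₀ K) (K₀ + K) (K₀ + K) => KeyOldLargeField (jcut K) (keyA₁₃ θ K₀ g₀ K s).2),
              classWeightOfDatum₉ F N θ.toStage9Params (datumOfRecord₁₃CoPH F N θ hP) g₀ os (runA₁₃ F K₀ g₀ K) (histA₁₃ θ K₀ g₀ K) (K₀ + K) t s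
            ≤ W K * ∑ s, classWeightOfDatum₉ F N θ.toStage9Params (datumOfRecord₁₃CoPH F N θ hP) g₀ os (runA₁₃ F K₀ g₀ K) (histA₁₃ θ K₀ g₀ K) (K₀ + K) t s) ∧
        (∀ (K : ℕ) (t : ℝ), |t| ≤ 1 →
          ∑ s' ∈ Finset.univ.filter (fun s' : SeqOfRecord F θ.ν θ.τ9.M (histB₁₃ θ K₀ g₀ K) (K₀ + K + 1) (K₀ + K + 1) => KeyOldLargeField (jcut K) (keyB₁₃ θ K₀ g₀ K s').2),
              classWeightOfDatum₉ F N θ.toStage9Params (datumOfRecord₁₃CoPH F N θ hP) g₀ os (runB₁₃ F K₀ g₀ K) (histB₁₃ θ K₀ g₀ K) (K₀ + K + 1) t s'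
            ≤ W K * ∑ s', classWeightOfDatum₉ F N θ.toStage9Params (datumOfRecord₁₃CoPH F N θ hP) g₀ os (runB₁₃ F K₀ g₀ K) (histB₁₃ θ K₀ g₀ K) (K₀ + K + 1) t s'))
    (F : T4Family) (θ : Stage13HParams F N) (hP : θ.Provisos₁₃CoPH F N) (hRg : Rg F θ) (hθ : θ.Admissible F N) (g₀ : ℕ → ℝ) (os : List (ULoop F)) :
    RelWeightBound (crOfRecord₁₃VAt K₀ jcut sh F θ hP g₀ os).l₀ (crOfRecord₁₃VAt K₀ jcut sh F θ hP g₀ os).T (crOfRecord₁₃VAt K₀ jcut sh F θ hP g₀ os).A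
      (crOfRecord₁₃VAt K₀ jcut sh F θ hP g₀ os).B (crOfRecord₁₃VAt K₀ jcut sh F θ hP g₀ os).Bad (crOfRecord₁₃VAt K₀ jcut sh F θ hP g₀ os).W := by
  obtain ⟨W, hW0, hW1, hWs, hA, hB⟩ := hterm F θ hP hRg hθ g₀ os
  exact relWeightBound_crOfRecord₁₃VAt_of_termBounds K₀ jcut sh θ hP g₀ os hW0 hW1 hWs hA hB

open Classical in
/-- ★★ **THE NODE AT THE REGIME-RESTRICTED HOME** `S_N20 (SRec₁₃CoPHOn (crOfRecord₁₃VAt K₀ jcut sh) Rg)` (dag-n19-d `s_N20_sRec₁₃CoPHOn_iff`) from the per-tuple witnesses on the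
regime. [bookkeeping] -/
theorem s_N20_sRec₁₃CoPHOn_crOfRecord₁₃VAt_of_termBounds
    (hterm : ∀ (F : T4Family) (θ : Stage13HParams F N) (hP : θ.Provisos₁₃CoPH F N), Rg F θ → θ.Admissible F N → ∀ (g₀ : ℕ → ℝ) (os : List (ULoop F)),
      ∃ W : ℕ → ℝ, (∀ K, 0 ≤ W K) ∧ (∀ K, W K < 1) ∧ Summable W ∧
        (∀ (K : ℕ) (t : ℝ), |t| ≤ 1 →
          ∑ s ∈ Finset.univ.filter (fun s : SeqOfRecord F θ.ν θ.τ9.M (histA₁₃ θ K₀ g₀ K) (K₀ + K) (K₀ + K) => KeyOldLargeField (jcut K) (keyA₁₃ θ K₀ g₀ K s).2),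
              classWeightOfDatum₉ F N θ.toStage9Params (datumOfRecord₁₃CoPH F N θ hP) g₀ os (runA₁₃ F K₀ g₀ K) (histA₁₃ θ K₀ g₀ K) (K₀ + K) t s
            ≤ W K * ∑ s, classWeightOfDatum₉ F N θ.toStage9Params (datumOfRecord₁₃CoPH F N θ hP) g₀ os (runA₁₃ F K₀ g₀ K) (histA₁₃ θ K₀ g₀ K) (K₀ + K) t s) ∧
        (∀ (K : ℕ) (t : ℝ), |t| ≤ 1 →
          ∑ s' ∈ Finset.univ.filter (fun s' : SeqOfRecord F θ.ν θ.τ9.M (histB₁₃ θ K₀ g₀ K) (K₀ + K + 1) (K₀ + K + 1) => KeyOldLargeField (jcut K) (keyB₁₃ θ K₀ g₀ K s').2),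
              classWeightOfDatum₉ F N θ.toStage9Params (datumOfRecord₁₃CoPH F N θ hP) g₀ os (runB₁₃ F K₀ g₀ K) (histB₁₃ θ K₀ g₀ K) (K₀ + K + 1) t s'
            ≤ W K * ∑ s', classWeightOfDatum₉ F N θ.toStage9Params (datumOfRecord₁₃CoPH F N θ hP) g₀ os (runB₁₃ F K₀ g₀ K) (histB₁₃ θ K₀ g₀ K) (K₀ + K + 1) t s')) :
    S_N20 (SRec₁₃CoPHOn (crOfRecord₁₃VAt K₀ jcut sh) Rg) :=
  (s_N20_sRec₁₃CoPHOn_iff (crOfRecord₁₃VAt K₀ jcut sh) Rg).2 (relWeightBound_guarded_crOfRecord₁₃VAt_of_termBounds K₀ jcut sh Rg hterm)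

end Reading

/-! ## §2 The SHELL face at the V reading (shell socket §1 + dag-n20-d's `shellWeightBound_crOfRecord₁₃VAt`) -/

section ShellAtReading

variable (K₀ : ℕ) (jcut : ℕ → ℕ) (sh : ShellSplit₁₃CoPH N K₀)

/-- ★★ **N21's FACE AT THE READING OF RECORD, ONE TUPLE, FROM A TERM-LEVEL SHELL SPLIT.**  IF the reading's keyed shell split at the tuple is the fibre sum of term-level shell
pieces `σa ∕ σb` over `keyA₁₃ ∕ keyB₁₃` (displayed equations `hshA ∕ hshB`, dag-n20-d's classical `DecidableEq` spelling), `0 ≤ Wsh`, `Σ Wsh < ∞`, termwise `0 ≤ σ ≤` the class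
weight and — THE BODY OF N21, DISPLAYED, NOT PROVED — the two TOTAL shell bounds hold, THEN `ShellWeightBound` AT `crOfRecord₁₃VAt K₀ jcut sh F θ hP g₀ os` (its `Wsh` the
canonical one). [bookkeeping] -/
theorem shellWeightBound_crOfRecord₁₃VAt_of_termShell (θ : Stage13HParams F N) (hP : θ.Provisos₁₃CoPH F N) (g₀ : ℕ → ℝ) (os : List (ULoop F))
    (σa : (K : ℕ) → ℝ → SeqOfRecord F θ.ν θ.τ9.M (histA₁₃ θ K₀ g₀ K) (K₀ + K) (K₀ + K) → ℝ)
    (σb : (K : ℕ) → ℝ → SeqOfRecord F θ.ν θ.τ9.M (histB₁₃ θ K₀ g₀ K) (K₀ + K + 1) (K₀ + K + 1) → ℝ)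
    (hshA : letI : ∀ Kc, DecidableEq (SiteSeqKey F Kc) := fun _ => Classical.decEq _
      (sh F θ hP g₀ os).1 = fun K t x => ∑ s ∈ Finset.univ.filter (fun s => keyA₁₃ θ K₀ g₀ K s = x), σa K t s)
    (hshB : letI : ∀ Kc, DecidableEq (SiteSeqKey F Kc) := fun _ => Classical.decEq _
      (sh F θ hP g₀ os).2 = fun K t x => ∑ s' ∈ Finset.univ.filter (fun s' => keyB₁₃ θ K₀ g₀ K s' = x), σb K t s')
    {Wsh : ℕ → ℝ} (hW0 : ∀ K, 0 ≤ Wsh K) (hWs : Summable Wsh)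
    (hσa0 : ∀ (K : ℕ) (t : ℝ), |t| ≤ 1 → ∀ s, 0 ≤ σa K t s)
    (hσa : ∀ (K : ℕ) (t : ℝ), |t| ≤ 1 → ∀ s,
      σa K t s ≤ classWeightOfDatum₉ F N θ.toStage9Params (datumOfRecord₁₃CoPH F N θ hP) g₀ os (runA₁₃ F K₀ g₀ K) (histA₁₃ θ K₀ g₀ K) (K₀ + K) t s)
    (hσb0 : ∀ (K : ℕ) (t : ℝ), |t| ≤ 1 → ∀ s', 0 ≤ σb K t s')
    (hσb : ∀ (K : ℕ) (t : ℝ), |t| ≤ 1 → ∀ s',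
      σb K t s' ≤ classWeightOfDatum₉ F N θ.toStage9Params (datumOfRecord₁₃CoPH F N θ hP) g₀ os (runB₁₃ F K₀ g₀ K) (histB₁₃ θ K₀ g₀ K) (K₀ + K + 1) t s')
    (hA : ∀ (K : ℕ) (t : ℝ), |t| ≤ 1 →
      ∑ s, σa K t s ≤ Wsh K * ∑ s, classWeightOfDatum₉ F N θ.toStage9Params (datumOfRecord₁₃CoPH F N θ hP) g₀ os (runA₁₃ F K₀ g₀ K) (histA₁₃ θ K₀ g₀ K) (K₀ + K) t s)
    (hB : ∀ (K : ℕ) (t : ℝ), |t| ≤ 1 →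
      ∑ s', σb K t s' ≤ Wsh K * ∑ s', classWeightOfDatum₉ F N θ.toStage9Params (datumOfRecord₁₃CoPH F N θ hP) g₀ os (runB₁₃ F K₀ g₀ K) (histB₁₃ θ K₀ g₀ K) (K₀ + K + 1) t s') :
    ShellWeightBound (crOfRecord₁₃VAt K₀ jcut sh F θ hP g₀ os).l₀ (crOfRecord₁₃VAt K₀ jcut sh F θ hP g₀ os).T (crOfRecord₁₃VAt K₀ jcut sh F θ hP g₀ os).A
      (crOfRecord₁₃VAt K₀ jcut sh F θ hP g₀ os).B (crOfRecord₁₃VAt K₀ jcut sh F θ hP g₀ os).shA (crOfRecord₁₃VAt K₀ jcut sh F θ hP g₀ os).shB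
      (crOfRecord₁₃VAt K₀ jcut sh F θ hP g₀ os).Wsh := by
  letI : ∀ Kc, DecidableEq (SiteSeqKey F Kc) := fun _ => Classical.decEq _
  refine shellWeightBound_crOfRecord₁₃VAt K₀ jcut sh θ hP g₀ os (Wsh := Wsh) ?_
  rw [hshA, hshB]
  exact shellWeightBound_keyed_of_termShell (keyA₁₃ θ K₀ g₀) (keyB₁₃ θ K₀ g₀)
    (fun K t (s : SeqOfRecord F θ.ν θ.τ9.M (histA₁₃ θ K₀ g₀ K) (K₀ + K) (K₀ + K)) =>
      classWeightOfDatum₉ F N θ.toStage9Params (datumOfRecord₁₃CoPH F N θ hP) g₀ os (runA₁₃ F K₀ g₀ K) (histA₁₃ θ K₀ g₀ K) (K₀ + K) t s) σa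
    (fun K t (s' : SeqOfRecord F θ.ν θ.τ9.M (histB₁₃ θ K₀ g₀ K) (K₀ + K + 1) (K₀ + K + 1)) =>
      classWeightOfDatum₉ F N θ.toStage9Params (datumOfRecord₁₃CoPH F N θ hP) g₀ os (runB₁₃ F K₀ g₀ K) (histB₁₃ θ K₀ g₀ K) (K₀ + K + 1) t s') σb
    (keyA₁₃_mem_classSet₁₃ θ K₀ g₀) (keyB₁₃_mem_classSet₁₃ θ K₀ g₀) hW0 hWs hσa0 hσa hσb0 hσb hA hB

/-- ★★ **THE NODE N21 AT THE READING OF RECORD FROM TERM-LEVEL SHELL SPLITS**: if at every admissible Stage-13 tuple with provisos the reading's keyed shell split is the fibre sum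
of term-level pieces obeying the displayed clauses for SOME `Wsh` (`0 ≤ Wsh`, `Σ Wsh < ∞`), then `S_N21 (SRec₁₃CoPH (crOfRecord₁₃VAt K₀ jcut sh))` (dag-n19-d `s_N21_sRec₁₃CoPH_iff`).
[bookkeeping] -/
theorem s_N21_sRec₁₃CoPH_crOfRecord₁₃VAt_of_termShell
    (hterm : ∀ (F : T4Family) (θ : Stage13HParams F N) (hP : θ.Provisos₁₃CoPH F N), θ.Admissible F N → ∀ (g₀ : ℕ → ℝ) (os : List (ULoop F)),
      ∃ (σa : (K : ℕ) → ℝ → SeqOfRecord F θ.ν θ.τ9.M (histA₁₃ θ K₀ g₀ K) (K₀ + K) (K₀ + K) → ℝ)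
        (σb : (K : ℕ) → ℝ → SeqOfRecord F θ.ν θ.τ9.M (histB₁₃ θ K₀ g₀ K) (K₀ + K + 1) (K₀ + K + 1) → ℝ) (Wsh : ℕ → ℝ),
        (letI : ∀ Kc, DecidableEq (SiteSeqKey F Kc) := fun _ => Classical.decEq _
         (sh F θ hP g₀ os).1 = fun K t x => ∑ s ∈ Finset.univ.filter (fun s => keyA₁₃ θ K₀ g₀ K s = x), σa K t s) ∧
        (letI : ∀ Kc, DecidableEq (SiteSeqKey F Kc) := fun _ => Classical.decEq _
         (sh F θ hP g₀ os).2 = fun K t x => ∑ s' ∈ Finset.univ.filter (fun s' => keyB₁₃ θ K₀ g₀ K s' = x), σb K t s') ∧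
        (∀ K, 0 ≤ Wsh K) ∧ Summable Wsh ∧
        (∀ (K : ℕ) (t : ℝ), |t| ≤ 1 → ∀ s, 0 ≤ σa K t s) ∧
        (∀ (K : ℕ) (t : ℝ), |t| ≤ 1 → ∀ s,
          σa K t s ≤ classWeightOfDatum₉ F N θ.toStage9Params (datumOfRecord₁₃CoPH F N θ hP) g₀ os (runA₁₃ F K₀ g₀ K) (histA₁₃ θ K₀ g₀ K) (K₀ + K) t s) ∧
        (∀ (K : ℕ) (t : ℝ), |t| ≤ 1 → ∀ s', 0 ≤ σb K t s') ∧
        (∀ (K : ℕ) (t : ℝ), |t| ≤ 1 → ∀ s',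
          σb K t s' ≤ classWeightOfDatum₉ F N θ.toStage9Params (datumOfRecord₁₃CoPH F N θ hP) g₀ os (runB₁₃ F K₀ g₀ K) (histB₁₃ θ K₀ g₀ K) (K₀ + K + 1) t s') ∧
        (∀ (K : ℕ) (t : ℝ), |t| ≤ 1 →
          ∑ s, σa K t s ≤ Wsh K * ∑ s, classWeightOfDatum₉ F N θ.toStage9Params (datumOfRecord₁₃CoPH F N θ hP) g₀ os (runA₁₃ F K₀ g₀ K) (histA₁₃ θ K₀ g₀ K) (K₀ + K) t s) ∧
        (∀ (K : ℕ) (t : ℝ), |t| ≤ 1 →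
          ∑ s', σb K t s' ≤ Wsh K * ∑ s', classWeightOfDatum₉ F N θ.toStage9Params (datumOfRecord₁₃CoPH F N θ hP) g₀ os (runB₁₃ F K₀ g₀ K) (histB₁₃ θ K₀ g₀ K) (K₀ + K + 1) t s')) :
    S_N21 (SRec₁₃CoPH (crOfRecord₁₃VAt K₀ jcut sh)) := by
  rw [s_N21_sRec₁₃CoPH_iff]
  intro F θ hP hθ g₀ os
  obtain ⟨σa, σb, Wsh, hshA, hshB, hW0, hWs, hσa0, hσa, hσb0, hσb, hA, hB⟩ := hterm F θ hP hθ g₀ os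
  exact shellWeightBound_crOfRecord₁₃VAt_of_termShell K₀ jcut sh θ hP g₀ os σa σb hshA hshB hW0 hWs hσa0 hσa hσb0 hσb hA hB

end ShellAtReading

end Summit.QuantumFields.YangMills.BalabanUVNodes.N20KeyedRelWeightSocketAtRecord13CoPHV

end
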